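import Mathlib

/-!
# The comparable antipodal form on finsets is nonnegative (blind cell PercRepro2, mine-a g47)

For a finite set `D` of positions and two fixed sets `G ⊆ G'` (the edges pinned closed in the
first and in the second copy), colour `τ ⊆ D` red and `D ∖ τ` blue; for `{0,1}`-valued antitone
functions `f g` of the closed set the *comparable antipodal form*

  `Σ_{τ ⊆ D} (f (τ ∪ G) − f ((D ∖ τ) ∪ G')) · (g (τ ∪ G) − g ((D ∖ τ) ∪ G'))`

is nonnegative (`antipodal_comparable_nonneg`).  This is Kleitman's form of Harris' inequality at
`p = ½`: with the families `𝒜 = {τ ⊆ D | f(τ ∪ G) = 1}` (a lower set),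
`𝒜' = {τ ⊆ D | f((D∖τ) ∪ G') = 1}` (an upper set inside the power set of `D`) and `ℬ, ℬ'`
likewise, the sum is `#(𝒜∩ℬ) − #(𝒜∩ℬ') − #(𝒜'∩ℬ) + #(𝒜'∩ℬ')`; the Harris–Kleitman inequality
(`IsLowerSet.le_card_inter_finset'`) bounds each term, and `#𝒜' ≤ #𝒜`, `#ℬ' ≤ #ℬ` because the
second copy is pinned closed on the larger set, so `2^{#D} · Σ ≥ (#𝒜 − #𝒜')(#ℬ − #ℬ') ≥ 0`.
It is the pinned-closed base case of the three-event inequality (T_h) on cycles (MINE-A.md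
§102.2, proofs/MINEA-CYCLE.md): when an edge is pinned closed on one side of the hit vertex, the
hit event forces every red edge to that side and the base case is this comparable form; the
special case `G = G' = ∅` is the antipodal Harris form itself.  No instance, no notation.
-/

namespace Summit.Ventures.PercRepro2

namespace AntipodalKleitman

open Finset

variable {α : Type*} [DecidableEq α]

section Families

variable (D G G' : Finset α) (f : Finset α → ℤ)

/-- The red sets whose first-copy value is `1`: a lower set. -/
def lowFam : Finset (Finset α) := D.powerset.filter fun τ => f (τ ∪ G) = 1

/-- The red sets whose second-copy value is `1`: an upper set inside the power set of `D`. -/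
def highFam : Finset (Finset α) := D.powerset.filter fun τ => f ((D \ τ) ∪ G') = 1

/-- The complement of `highFam` inside the power set of `D`: a lower set. -/
def highCompl : Finset (Finset α) := D.powerset.filter fun τ => ¬ f ((D \ τ) ∪ G') = 1

/-- Membership in `lowFam`. -/
lemma mem_lowFam {τ : Finset α} : τ ∈ lowFam D G f ↔ τ ⊆ D ∧ f (τ ∪ G) = 1 := by
  simp [lowFam]

/-- Membership in `highFam`. -/
lemma mem_highFam {τ : Finset α} : τ ∈ highFam D G' f ↔ τ ⊆ D ∧ f ((D \ τ) ∪ G') = 1 := by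
  simp [highFam]

/-- Membership in `highCompl`. -/
lemma mem_highCompl {τ : Finset α} :
    τ ∈ highCompl D G' f ↔ τ ⊆ D ∧ ¬ f ((D \ τ) ∪ G') = 1 := by
  simp [highCompl]

/-- `lowFam` lies in the power set of `D`. -/
lemma lowFam_subset : lowFam D G f ⊆ D.powerset := filter_subset _ _

/-- `highFam` lies in the power set of `D`. -/
lemma highFam_subset : highFam D G' f ⊆ D.powerset := filter_subset _ _

/-- `highCompl` lies in the power set of `D`. -/
lemma highCompl_subset : highCompl D G' f ⊆ D.powerset := filter_subset _ _

/-- `highFam` and `highCompl` partition the power set of `D`. -/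
lemma highFam_union_highCompl : highFam D G' f ∪ highCompl D G' f = D.powerset :=
  filter_union_filter_not_eq _ _

/-- `highFam` and `highCompl` are disjoint. -/
lemma disjoint_highFam_highCompl : Disjoint (highFam D G' f) (highCompl D G' f) :=
  disjoint_filter_filter_not _ _ _

/-- The cardinalities of `highFam` and `highCompl` add up to `2 ^ #D`. -/
lemma card_highFam_add_card_highCompl :
    (highFam D G' f).card + (highCompl D G' f).card = 2 ^ D.card := by
  rw [← card_powerset, ← highFam_union_highCompl D G' f,
    card_union_of_disjoint (disjoint_highFam_highCompl D G' f)]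

/-- `lowFam` is a lower set (for `{0,1}`-valued antitone `f`). -/
lemma isLowerSet_lowFam (hf01 : ∀ Z, f Z = 0 ∨ f Z = 1) (hf : Antitone f) :
    IsLowerSet (lowFam D G f : Set (Finset α)) := by
  intro τ τ' hle hτ
  rw [mem_coe, mem_lowFam] at hτ ⊢
  obtain ⟨hτD, hτf⟩ := hτ
  refine ⟨le_trans hle hτD, ?_⟩
  have h1 : f (τ ∪ G) ≤ f (τ' ∪ G) := hf (union_subset_union hle (le_refl G))
  rcases hf01 (τ' ∪ G) with h | h <;> omega

/-- `highCompl` is a lower set (for `{0,1}`-valued antitone `f`). -/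
lemma isLowerSet_highCompl (hf01 : ∀ Z, f Z = 0 ∨ f Z = 1) (hf : Antitone f) :
    IsLowerSet (highCompl D G' f : Set (Finset α)) := by
  intro τ τ' hle hτ
  rw [mem_coe, mem_highCompl] at hτ ⊢
  obtain ⟨hτD, hτf⟩ := hτ
  refine ⟨le_trans hle hτD, ?_⟩
  have h1 : f ((D \ τ') ∪ G') ≤ f ((D \ τ) ∪ G') :=
    hf (union_subset_union (sdiff_subset_sdiff (le_refl D) hle) (le_refl G'))
  rcases hf01 ((D \ τ) ∪ G') with h | h <;> rcases hf01 ((D \ τ') ∪ G') with h' | h' <;> omega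

/-- The second-copy family is no larger than the first-copy family when `G ⊆ G'`: complementing
inside `D` injects it. -/
lemma card_highFam_le_card_lowFam (hGG' : G ⊆ G') (hf01 : ∀ Z, f Z = 0 ∨ f Z = 1)
    (hf : Antitone f) : (highFam D G' f).card ≤ (lowFam D G f).card := by
  refine card_le_card_of_injOn (fun τ => D \ τ) ?_ ?_
  · intro τ hτ
    rw [mem_coe, mem_highFam] at hτ
    rw [mem_coe, mem_lowFam]
    refine ⟨sdiff_subset, ?_⟩
    have h1 : f ((D \ τ) ∪ G') ≤ f ((D \ τ) ∪ G) := hf (union_subset_union (le_refl _) hGG')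
    rcases hf01 ((D \ τ) ∪ G) with h | h <;> omega
  · intro τ hτ τ' hτ' heq
    rw [mem_coe, mem_highFam] at hτ hτ'
    have h1 : D \ (D \ τ) = τ := Finset.sdiff_sdiff_eq_self hτ.1
    have h2 : D \ (D \ τ') = τ' := Finset.sdiff_sdiff_eq_self hτ'.1
    rw [← h1, ← h2]
    simp only at heq
    rw [heq]

end Families

omit [DecidableEq α] in
/-- A `{0,1}`-valued function is the indicator of its level set `{= 1}`. -/
lemma eq_ite_of_zero_one {f : Finset α → ℤ} (hf01 : ∀ Z, f Z = 0 ∨ f Z = 1) (Z : Finset α) :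
    f Z = if f Z = 1 then 1 else 0 := by
  rcases hf01 Z with h | h <;> simp [h]

/-! ## The four Harris–Kleitman bounds -/

section Bounds

variable (D G G' : Finset α) (f g : Finset α → ℤ)

/-- Two lower families correlate. -/
lemma bound_low_low (hf01 : ∀ Z, f Z = 0 ∨ f Z = 1) (hf : Antitone f)
    (hg01 : ∀ Z, g Z = 0 ∨ g Z = 1) (hg : Antitone g) :
    (lowFam D G f).card * (lowFam D G g).card ≤
      2 ^ D.card * (lowFam D G f ∩ lowFam D G g).card :=
  (isLowerSet_lowFam D G f hf01 hf).le_card_inter_finset' (isLowerSet_lowFam D G g hg01 hg)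
    (fun _ ht => mem_powerset.1 (lowFam_subset D G f ht))
    (fun _ ht => mem_powerset.1 (lowFam_subset D G g ht))

/-- A lower family and the upper family of the other function anticorrelate. -/
lemma bound_low_high (hf01 : ∀ Z, f Z = 0 ∨ f Z = 1) (hf : Antitone f)
    (hg01 : ∀ Z, g Z = 0 ∨ g Z = 1) (hg : Antitone g) :
    2 ^ D.card * (lowFam D G f ∩ highFam D G' g).card ≤
      (lowFam D G f).card * (highFam D G' g).card := by
  -- Harris–Kleitman for `lowFam f` and the complement of `highFam g`
  have hHK := (isLowerSet_lowFam D G f hf01 hf).le_card_inter_finset'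
    (isLowerSet_highCompl D G' g hg01 hg)
    (fun _ ht => mem_powerset.1 (lowFam_subset D G f ht))
    (fun _ ht => mem_powerset.1 (highCompl_subset D G' g ht))
  -- `lowFam f` splits along `highFam g` and its complement
  have hsplit : (lowFam D G f ∩ highFam D G' g).card + (lowFam D G f ∩ highCompl D G' g).card =
      (lowFam D G f).card := by
    rw [← card_union_of_disjoint (disjoint_of_subset_left inter_subset_right
      (disjoint_of_subset_right inter_subset_right (disjoint_highFam_highCompl D G' g))),
      ← inter_union_distrib_left, highFam_union_highCompl,
      inter_eq_left.2 (lowFam_subset D G f)]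
  have hcompl := card_highFam_add_card_highCompl D G' g
  nlinarith [hHK, hsplit, hcompl]

/-- The upper family of the first function and a lower family anticorrelate. -/
lemma bound_high_low (hf01 : ∀ Z, f Z = 0 ∨ f Z = 1) (hf : Antitone f)
    (hg01 : ∀ Z, g Z = 0 ∨ g Z = 1) (hg : Antitone g) :
    2 ^ D.card * (highFam D G' f ∩ lowFam D G g).card ≤
      (highFam D G' f).card * (lowFam D G g).card := by
  rw [inter_comm, mul_comm (highFam D G' f).card]
  exact bound_low_high D G G' g f hg01 hg hf01 hf

/-- Two upper families correlate. -/
lemma bound_high_high (hf01 : ∀ Z, f Z = 0 ∨ f Z = 1) (hf : Antitone f)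
    (hg01 : ∀ Z, g Z = 0 ∨ g Z = 1) (hg : Antitone g) :
    (highFam D G' f).card * (highFam D G' g).card ≤
      2 ^ D.card * (highFam D G' f ∩ highFam D G' g).card := by
  -- Harris–Kleitman for the two complements
  have hHK := (isLowerSet_highCompl D G' f hf01 hf).le_card_inter_finset'
    (isLowerSet_highCompl D G' g hg01 hg)
    (fun _ ht => mem_powerset.1 (highCompl_subset D G' f ht))
    (fun _ ht => mem_powerset.1 (highCompl_subset D G' g ht))
  -- inclusion–exclusion inside the power set of `D`
  have hf' := card_highFam_add_card_highCompl D G' f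
  have hg' := card_highFam_add_card_highCompl D G' g
  -- `highFam f ∩ highFam g` is the complement of `highCompl f ∪ highCompl g`
  have hcompl : (highFam D G' f ∩ highFam D G' g).card +
      (highCompl D G' f ∪ highCompl D G' g).card = 2 ^ D.card := by
    rw [← card_powerset (s := D)]
    have hdisj : Disjoint (highFam D G' f ∩ highFam D G' g)
        (highCompl D G' f ∪ highCompl D G' g) := by
      rw [disjoint_union_right]
      exact ⟨disjoint_of_subset_left inter_subset_left (disjoint_highFam_highCompl D G' f),
        disjoint_of_subset_left inter_subset_right (disjoint_highFam_highCompl D G' g)⟩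
    rw [← card_union_of_disjoint hdisj]
    congr 1
    ext τ
    simp only [mem_union, mem_inter, mem_highFam, mem_highCompl, mem_powerset]
    constructor
    · rintro (⟨⟨h, _⟩, _⟩ | ⟨h, _⟩ | ⟨h, _⟩) <;> exact h
    · intro h
      by_cases hf1 : f ((D \ τ) ∪ G') = 1 <;> by_cases hg1 : g ((D \ τ) ∪ G') = 1
      · exact Or.inl ⟨⟨h, hf1⟩, ⟨h, hg1⟩⟩
      · exact Or.inr (Or.inr ⟨h, hg1⟩)
      · exact Or.inr (Or.inl ⟨h, hf1⟩)
      · exact Or.inr (Or.inl ⟨h, hf1⟩)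
  have hunion := card_union_add_card_inter (highCompl D G' f) (highCompl D G' g)
  nlinarith [hHK, hf', hg', hcompl, hunion]

end Bounds

/-! ## The comparable antipodal form -/

section Main

variable (D G G' : Finset α) (f g : Finset α → ℤ)

/-- The comparable antipodal form as a signed count of the four intersections. -/
lemma sum_eq_cards (hf01 : ∀ Z, f Z = 0 ∨ f Z = 1) (hg01 : ∀ Z, g Z = 0 ∨ g Z = 1) :
    ∑ τ ∈ D.powerset, (f (τ ∪ G) - f ((D \ τ) ∪ G')) * (g (τ ∪ G) - g ((D \ τ) ∪ G')) =
      ((lowFam D G f ∩ lowFam D G g).card : ℤ) - (lowFam D G f ∩ highFam D G' g).card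
        - (highFam D G' f ∩ lowFam D G g).card + (highFam D G' f ∩ highFam D G' g).card := by
  have hexp : ∀ τ ∈ D.powerset,
      (f (τ ∪ G) - f ((D \ τ) ∪ G')) * (g (τ ∪ G) - g ((D \ τ) ∪ G')) =
        (if f (τ ∪ G) = 1 ∧ g (τ ∪ G) = 1 then (1 : ℤ) else 0)
          - (if f (τ ∪ G) = 1 ∧ g ((D \ τ) ∪ G') = 1 then 1 else 0)
          - (if f ((D \ τ) ∪ G') = 1 ∧ g (τ ∪ G) = 1 then 1 else 0)
          + (if f ((D \ τ) ∪ G') = 1 ∧ g ((D \ τ) ∪ G') = 1 then 1 else 0) := by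
    intro τ _
    rw [eq_ite_of_zero_one hf01 (τ ∪ G), eq_ite_of_zero_one hf01 ((D \ τ) ∪ G'),
      eq_ite_of_zero_one hg01 (τ ∪ G), eq_ite_of_zero_one hg01 ((D \ τ) ∪ G')]
    by_cases a : f (τ ∪ G) = 1 <;> by_cases b : f ((D \ τ) ∪ G') = 1 <;>
      by_cases c : g (τ ∪ G) = 1 <;> by_cases d : g ((D \ τ) ∪ G') = 1 <;>
      simp [a, b, c, d]
  rw [sum_congr rfl hexp, sum_add_distrib, sum_sub_distrib, sum_sub_distrib]
  simp only [sum_boole]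
  have e1 : D.powerset.filter (fun τ => f (τ ∪ G) = 1 ∧ g (τ ∪ G) = 1) =
      lowFam D G f ∩ lowFam D G g := by
    rw [filter_and]; rfl
  have e2 : D.powerset.filter (fun τ => f (τ ∪ G) = 1 ∧ g ((D \ τ) ∪ G') = 1) =
      lowFam D G f ∩ highFam D G' g := by
    rw [filter_and]; rfl
  have e3 : D.powerset.filter (fun τ => f ((D \ τ) ∪ G') = 1 ∧ g (τ ∪ G) = 1) =
      highFam D G' f ∩ lowFam D G g := by
    rw [filter_and]; rfl
  have e4 : D.powerset.filter (fun τ => f ((D \ τ) ∪ G') = 1 ∧ g ((D \ τ) ∪ G') = 1) =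
      highFam D G' f ∩ highFam D G' g := by
    rw [filter_and]; rfl
  rw [e1, e2, e3, e4]

/-- **The comparable antipodal form is nonnegative**: for `G ⊆ G'` and `{0,1}`-valued antitone
`f g`, `Σ_{τ ⊆ D} (f(τ ∪ G) − f((D∖τ) ∪ G'))(g(τ ∪ G) − g((D∖τ) ∪ G')) ≥ 0`. -/
theorem antipodal_comparable_nonneg (hGG' : G ⊆ G') (hf01 : ∀ Z, f Z = 0 ∨ f Z = 1)
    (hf : Antitone f) (hg01 : ∀ Z, g Z = 0 ∨ g Z = 1) (hg : Antitone g) :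
    0 ≤ ∑ τ ∈ D.powerset, (f (τ ∪ G) - f ((D \ τ) ∪ G')) * (g (τ ∪ G) - g ((D \ τ) ∪ G')) := by
  rw [sum_eq_cards D G G' f g hf01 hg01]
  have h1 := bound_low_low D G f g hf01 hf hg01 hg
  have h2 := bound_low_high D G G' f g hf01 hf hg01 hg
  have h3 := bound_high_low D G G' f g hf01 hf hg01 hg
  have h4 := bound_high_high D G' f g hf01 hf hg01 hg
  have h5 := card_highFam_le_card_lowFam D G G' f hGG' hf01 hf
  have h6 := card_highFam_le_card_lowFam D G G' g hGG' hg01 hg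
  have hN : (0 : ℤ) < 2 ^ D.card := by positivity
  have h1' : ((lowFam D G f).card : ℤ) * ((lowFam D G g).card : ℤ) ≤
      (2 : ℤ) ^ D.card * ((lowFam D G f ∩ lowFam D G g).card : ℤ) := by exact_mod_cast h1
  have h2' : (2 : ℤ) ^ D.card * ((lowFam D G f ∩ highFam D G' g).card : ℤ) ≤
      ((lowFam D G f).card : ℤ) * ((highFam D G' g).card : ℤ) := by exact_mod_cast h2
  have h3' : (2 : ℤ) ^ D.card * ((highFam D G' f ∩ lowFam D G g).card : ℤ) ≤
      ((highFam D G' f).card : ℤ) * ((lowFam D G g).card : ℤ) := by exact_mod_cast h3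
  have h4' : ((highFam D G' f).card : ℤ) * ((highFam D G' g).card : ℤ) ≤
      (2 : ℤ) ^ D.card * ((highFam D G' f ∩ highFam D G' g).card : ℤ) := by exact_mod_cast h4
  have h5' : ((highFam D G' f).card : ℤ) ≤ ((lowFam D G f).card : ℤ) := by exact_mod_cast h5
  have h6' : ((highFam D G' g).card : ℤ) ≤ ((lowFam D G g).card : ℤ) := by exact_mod_cast h6
  have hprod : 0 ≤ (((lowFam D G f).card : ℤ) - ((highFam D G' f).card : ℤ)) *
      (((lowFam D G g).card : ℤ) - ((highFam D G' g).card : ℤ)) :=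
    mul_nonneg (by linarith) (by linarith)
  have hNS : 0 ≤ (2 : ℤ) ^ D.card *
      (((lowFam D G f ∩ lowFam D G g).card : ℤ) - ((lowFam D G f ∩ highFam D G' g).card : ℤ)
        - ((highFam D G' f ∩ lowFam D G g).card : ℤ)
        + ((highFam D G' f ∩ highFam D G' g).card : ℤ)) := by
    nlinarith [h1', h2', h3', h4', hprod]
  exact (mul_nonneg_iff_of_pos_left hN).1 hNS

end Main

end AntipodalKleitman

end Summit.Ventures.PercRepro2
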